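import Summits.BirchSwinnertonDyer.BirchSwinnertonDyer.Theorems.UniversalToricDescentThinCombFrameOrbit
import Summits.BirchSwinnertonDyer.BirchSwinnertonDyer.Theorems.UniversalToricDescentThinCombDefs
import Summits.BirchSwinnertonDyer.Rank1Residual.X2.HidaLimitCongruenceAlgebra
import HarnessLib

/-!
# COROLLARIES OF THE ORBIT THEOREM FOR ♯♯-FRAMES: frames with the same constant `C` differ by a group-like unit on the nose; the orbit
# theorem for different periods and inside `R₀⟦T₁⟧⟦T₂⟧`; rational thin-comb divisibility (item 32493) is constant on the orbit (helper on the rational wall `RationalSplitIMCInclusionAtThree`, stmt-BirchSwinnertonDyer-24207, line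
# `ratwall_thin_comb` v11/v12; cell `pub/bsd-wall`, LEAD `cruxlead-24207` g39; `--supports stmt-BirchSwinnertonDyer-24207`; nothing is closed;
# BSD is not proved)

Companion of `…ThinComb.FrameOrbit` (split off by the 400-line rule). From the ORBIT THEOREM
`…FrameOrbit.exists_groupLike_of_isToricTwoVarLFunctionUpTo₂_pair` (`(3^k C)·L′ = (3^k C′)·[g₀]·L` for two non-zero ♯♯-frames of one datum):

* **`eq_groupLike_mul_of_isToricTwoVarLFunctionUpTo₂_pair`** — frames with the SAME constant `C` (any `X, Y, X′, Y′ ≠ 0`) differ by a group-like unit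
  ON THE NOSE: `L′ = (1+T₁)^{κ₁ g₀}(1+T₂)^{κ₂ g₀} · L` (cancel the common integral scalar in the domain `𝒪_{ℂ₃}⟦T₁⟧⟦T₂⟧`, then `toInt₂` is injective).
  Contains `…FrameUniqueness` §1 (`X′ = X`, `Y′ = Y`) and §2 (constants differing by units of `ℤ₃`), and — with `…FrameReflection` (the reflected
  frame `φ_{A_τ}L` is a `(C, Y/κ̂, X·κ̂)`-frame) — the frame functional equation of `…FrameFunctionalEquation`.
* **`associated_of_isToricTwoVarLFunctionUpTo₂_pair`** — such frames are associated (`…FrameUniqueness.isUnit_groupLike`).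
* **`exists_groupLike_of_isToricTwoVarLFunctionUpTo₂_pair_period`** — the orbit theorem for frames with DIFFERENT periods `Ω_K, Ω_K′ ≠ 0`
  (transport both to the period `1`, `…FrameSizeInvariance.isToricTwoVarLFunctionUpTo₂_period_one`).
* **`exists_unr_mul_eq_of_isToricTwoVarLFunctionUpTo₂_pair`** — THE ORBIT THEOREM INSIDE `R₀⟦T₁⟧⟦T₂⟧`: `C(C s)·L′ = C(C t)·[g₀]·L` with
  `s, t ∈ R₀ ∖ 0`, `t·C = s·C′` (compare one coefficient where `[g₀]·L ≠ 0`, cancel `3^k C`). Hence `C′/C ∈ Frac(W(𝔽̄₃))ˣ = 3^ℤ·R₀ˣ`: the constant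
  of a frame is canonical up to `3^ℤ·R₀ˣ` (`‖C′‖/‖C‖ ∈ 3^ℤ`), the non-zero frames form ONE orbit under `3^ℤ·R₀ˣ·Γ_K`, and every ideal-theoretic
  statement with `3`-power slack about «all frames» (item 32493) is a statement about any one of them.

* **`ThinCombDvdRat.mul_left`, `ThinCombDvdRat.of_const_mul_eq`, `thinCombDvdRat_zero`** (any `𝒪`, `p`) and
  **`thinCombDvdRat_of_isToricTwoVarLFunctionUpTo₂_pair`, `thinCombDvdRat_of_exists_frame`** (`p = 3`) — RATIONAL THIN-COMB DIVISIBILITY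
  (`ThinCombDvdRat R₀ 3 G L₂`: on comb levels of unbounded order `3^{t_m}·L₂ ∈ (G, E_m(T₂))` for SOME slack, the conclusion of route item
  stmt-BirchSwinnertonDyer-32493) PASSES BETWEEN NON-ZERO FRAMES (`s = u·3^b` in the DVR `R₀`, slack `+b`): item 32493's `∀ L₂` is decided by ANY
  ONE non-zero frame (the zero frame trivially) — it may be verified on one convenient normalisation, and one frame violating it refutes it for all.

HONEST SCOPE: statements about the interpolation predicate, conditional on the named print fact `jacquet1972_functionalEquation_rankinSelbergHecke_cone`;
nothing here is evidence that a frame exists or that the divisibility holds at an additive split `3`; BSD is proved for no curve;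
24207 / 20395 / 20186 / 32493 OPEN.

References: [cite: HaoLoeffler2025, Thm. 3.5 and remark, §4 Thm. 4.9 (arXiv:2405.12611)] [cite: CastellaWan2023, §2.4 Thm. 2.11 (arXiv:1607.02019)]
[cite: Jacquet1972, §19 Cor. 19.15] [cite: deShalit1987, II.4.17 (54), II.6.4] [cite: Washington1997, §7.1, Prop. 7.2]
[cite: Gu2025FiniteSlopeUniversalRS, Conj. 2.15 (arXiv:2512.01184)]
-/

set_option linter.dupNamespace false
set_option autoImplicit false

noncomputable section

open scoped Classical MatrixGroups

namespace Summit.BirchSwinnertonDyer.BirchSwinnertonDyer.Theorems.UniversalToricDescentThinComb.FrameOrbitCorollaries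

open NumberField IsDedekindDomain Field
open Literature.NumberTheory.EllipticCurves Literature.NumberTheory.GaloisRepresentations Literature.NumberTheory.LocalFields
open Summit.BirchSwinnertonDyer.Rank1Residual.X11b.Halves
open Summit.BirchSwinnertonDyer.BirchSwinnertonDyer.Theorems.UniversalToricDescentThinComb
open Summit.BirchSwinnertonDyer.BirchSwinnertonDyer.Theorems.UniversalToricDescentThinComb.FrameOrbit

variable {K : Type} [Field K] [NumberField K]

/-- **Frames with the SAME constant `C` differ by a group-like unit ON THE NOSE**: if `L ≠ 0` is a `(C, X, Y)`-frame and `L′ ≠ 0` a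
`(C, X′, Y′)`-frame of the same datum and period (`C, X, Y, X′, Y′ ≠ 0`), then `L′ = (1+T₁)^{κ₁ g₀}(1+T₂)^{κ₂ g₀} · L` for some `g₀ ∈ Γ_K`. Contains
`…FrameUniqueness` §1 (`X′ = X`, `Y′ = Y`: then necessarily `[g₀]·L = L`) and §2 (constants differing by units of `ℤ₃`), and — with
`…FrameReflection` (the reflected frame `φ_{A_τ}L` is a `(C, Y/κ̂, X·κ̂)`-frame) — the frame functional equation of `…FrameFunctionalEquation`.
[cite: HaoLoeffler2025, Thm. 3.5, remark; §4 Thm. 4.9 (arXiv:2405.12611)] [cite: Jacquet1972, §19 Cor. 19.15] -/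
theorem eq_groupLike_mul_of_isToricTwoVarLFunctionUpTo₂_pair (hJ : jacquet1972_functionalEquation_rankinSelbergHecke_cone)
    (hK : IsImaginaryQuadratic K) {N : ℕ} [NeZero N] (W : WeierstrassCurve ℚ)
    (Dt : Literature.NumberTheory.EllipticCurves.ModularForms.ModularParametrizationData W N)
    (hH : SatisfiesHeegnerHypothesis N K)
    {𝔭 : HeightOneSpectrum (𝓞 K)} (h3 : ((3 : ℕ) : 𝓞 K) ∈ 𝔭.asIdeal)
    {𝔭' : HeightOneSpectrum (𝓞 K)} (h3' : ((3 : ℕ) : 𝓞 K) ∈ 𝔭'.asIdeal) (hne : 𝔭' ≠ 𝔭)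
    (ι' : PadicAlgCl 3 ≃+* ℂ) (hι : Summit.BirchSwinnertonDyer.BirchSwinnertonDyer.Theorems.SchneiderFree.BranchInducesPrime 3 ι' 𝔭)
    {κ₁ κ₂ : ZpExtension K 3} {γ₁ γ₂ : absoluteGaloisGroup K} (hpair : ZpExtension.IsTopGeneratorPair κ₁ κ₂ γ₁ γ₂)
    (hur₁ : ∀ v : HeightOneSpectrum (𝓞 K), v ≠ 𝔭 → ∀ 𝔓 ∈ v.primesAbove,
      𝔓.inertia (absoluteGaloisGroup K) ≤ κ₁.kerSubgroup)
    {ΩK : ℂ} {C X Y X' Y' : ℂ_[3]} {L L' : PowerSeries (UnrSeries 3)}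
    (hC : C ≠ 0) (hX : X ≠ 0) (hY : Y ≠ 0) (hX' : X' ≠ 0) (hY' : Y' ≠ 0)
    (hL : IsToricTwoVarLFunctionUpTo₂ C X Y ι' 𝔭 𝔭' κ₁ κ₂ γ₁ γ₂ Dt.f ΩK L) (hL0 : L ≠ 0)
    (hL' : IsToricTwoVarLFunctionUpTo₂ C X' Y' ι' 𝔭 𝔭' κ₁ κ₂ γ₁ γ₂ Dt.f ΩK L') (hL'0 : L' ≠ 0) :
    letI : Algebra ℤ_[3] (unrIntegers 3) := (toUnr 3).toAlgebra
    ∃ g₀ : absoluteGaloisGroup K,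
      L' = (PowerSeries.map (PowerSeries.C (R := unrIntegers 3))
              ((PowerSeries.binomialSeries ℤ_[3] (Multiplicative.toAdd (κ₁ g₀))).map (toUnr 3)) *
            PowerSeries.C ((PowerSeries.binomialSeries ℤ_[3] (Multiplicative.toAdd (κ₂ g₀))).map (toUnr 3))) * L := by
  letI : Algebra ℤ_[3] (unrIntegers 3) := (toUnr 3).toAlgebra
  obtain ⟨g₀, k, a, a', ha, ha', hid⟩ := exists_groupLike_of_isToricTwoVarLFunctionUpTo₂_pair hJ hK W Dt hH h3 h3' hne ι' hι hpair hur₁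
    hC hX hY hC hX' hY' hL hL0 hL' hL'0
  refine ⟨g₀, ?_⟩
  have haa : a = a' := Subtype.ext (by rw [ha, ha'])
  have h30 : ((3 : ℕ) : ℂ_[3]) ≠ 0 := by exact_mod_cast (show (3 : ℕ) ≠ 0 by norm_num)
  have ha0 : a ≠ 0 := by
    intro h0
    have : (a : ℂ_[3]) = 0 := by rw [h0]; rfl
    rw [ha] at this
    exact mul_ne_zero (pow_ne_zero _ h30) hC this
  have hCa0 : (PowerSeries.C (PowerSeries.C a) : PowerSeries (PowerSeries (PadicComplexInt 3))) ≠ 0 := by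
    intro h0
    apply ha0
    have h1 := congrArg (fun F ↦ PowerSeries.constantCoeff (PowerSeries.constantCoeff F)) h0
    simpa using h1
  rw [← haa] at hid
  set B : PowerSeries (UnrSeries 3) := PowerSeries.map (PowerSeries.C (R := unrIntegers 3))
      ((PowerSeries.binomialSeries ℤ_[3] (Multiplicative.toAdd (κ₁ g₀))).map (toUnr 3)) *
    PowerSeries.C ((PowerSeries.binomialSeries ℤ_[3] (Multiplicative.toAdd (κ₂ g₀))).map (toUnr 3)) with hB
  have hsub : PowerSeries.C (PowerSeries.C a) * (UnrSeries.toInt₂ L' - UnrSeries.toInt₂ (B * L)) = 0 := by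
    rw [mul_sub, hid, sub_self]
  have hq := (mul_eq_zero.mp hsub).resolve_left hCa0
  exact UnrSeries.toInt₂_injective (sub_eq_zero.mp hq)

/-- **Frames with the same constant `C` are ASSOCIATED** (the group-like element is a unit, `…FrameUniqueness.isUnit_groupLike`).
[cite: HaoLoeffler2025, Thm. 3.5, remark (arXiv:2405.12611)] [cite: Jacquet1972, §19 Cor. 19.15] -/
theorem associated_of_isToricTwoVarLFunctionUpTo₂_pair (hJ : jacquet1972_functionalEquation_rankinSelbergHecke_cone)
    (hK : IsImaginaryQuadratic K) {N : ℕ} [NeZero N] (W : WeierstrassCurve ℚ)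
    (Dt : Literature.NumberTheory.EllipticCurves.ModularForms.ModularParametrizationData W N)
    (hH : SatisfiesHeegnerHypothesis N K)
    {𝔭 : HeightOneSpectrum (𝓞 K)} (h3 : ((3 : ℕ) : 𝓞 K) ∈ 𝔭.asIdeal)
    {𝔭' : HeightOneSpectrum (𝓞 K)} (h3' : ((3 : ℕ) : 𝓞 K) ∈ 𝔭'.asIdeal) (hne : 𝔭' ≠ 𝔭)
    (ι' : PadicAlgCl 3 ≃+* ℂ) (hι : Summit.BirchSwinnertonDyer.BirchSwinnertonDyer.Theorems.SchneiderFree.BranchInducesPrime 3 ι' 𝔭)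
    {κ₁ κ₂ : ZpExtension K 3} {γ₁ γ₂ : absoluteGaloisGroup K} (hpair : ZpExtension.IsTopGeneratorPair κ₁ κ₂ γ₁ γ₂)
    (hur₁ : ∀ v : HeightOneSpectrum (𝓞 K), v ≠ 𝔭 → ∀ 𝔓 ∈ v.primesAbove,
      𝔓.inertia (absoluteGaloisGroup K) ≤ κ₁.kerSubgroup)
    {ΩK : ℂ} {C X Y X' Y' : ℂ_[3]} {L L' : PowerSeries (UnrSeries 3)}
    (hC : C ≠ 0) (hX : X ≠ 0) (hY : Y ≠ 0) (hX' : X' ≠ 0) (hY' : Y' ≠ 0)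
    (hL : IsToricTwoVarLFunctionUpTo₂ C X Y ι' 𝔭 𝔭' κ₁ κ₂ γ₁ γ₂ Dt.f ΩK L) (hL0 : L ≠ 0)
    (hL' : IsToricTwoVarLFunctionUpTo₂ C X' Y' ι' 𝔭 𝔭' κ₁ κ₂ γ₁ γ₂ Dt.f ΩK L') (hL'0 : L' ≠ 0) :
    Associated L' L := by
  letI : Algebra ℤ_[3] (unrIntegers 3) := (toUnr 3).toAlgebra
  obtain ⟨g₀, hg₀⟩ := eq_groupLike_mul_of_isToricTwoVarLFunctionUpTo₂_pair hJ hK W Dt hH h3 h3' hne ι' hι hpair hur₁ hC hX hY hX' hY'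
    hL hL0 hL' hL'0
  obtain ⟨Bu, hBu⟩ := FrameUniqueness.isUnit_groupLike (p := 3) (Multiplicative.toAdd (κ₁ g₀)) (Multiplicative.toAdd (κ₂ g₀))
  exact ⟨Bu⁻¹, by rw [hg₀, ← hBu, mul_comm ((Bu : PowerSeries (UnrSeries 3))) L, mul_assoc, Units.mul_inv, mul_one]⟩

/-- **THE ORBIT THEOREM for frames with DIFFERENT periods `Ω_K, Ω_K′ ≠ 0`** (all constants non-zero, both frames non-zero): there are
`g₀ ∈ Γ_K`, `k`, and integral scalars `a = 3^k C`, `a′ = 3^k C′` with `a · L′ = a′ · [g₀] · L` in `𝒪_{ℂ₃}⟦T₁⟧⟦T₂⟧` — transport both frames to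
the period `1` (`…FrameSizeInvariance.isToricTwoVarLFunctionUpTo₂_period_one`) and apply §2.
[cite: HaoLoeffler2025, Thm. 3.5, remark (arXiv:2405.12611)] [cite: CastellaWan2023, §2.4 Thm. 2.11 (arXiv:1607.02019)] [cite: Jacquet1972, §19 Cor. 19.15] -/
theorem exists_groupLike_of_isToricTwoVarLFunctionUpTo₂_pair_period (hJ : jacquet1972_functionalEquation_rankinSelbergHecke_cone)
    (hK : IsImaginaryQuadratic K) {N : ℕ} [NeZero N] (W : WeierstrassCurve ℚ)
    (Dt : Literature.NumberTheory.EllipticCurves.ModularForms.ModularParametrizationData W N)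
    (hH : SatisfiesHeegnerHypothesis N K)
    {𝔭 : HeightOneSpectrum (𝓞 K)} (h3 : ((3 : ℕ) : 𝓞 K) ∈ 𝔭.asIdeal)
    {𝔭' : HeightOneSpectrum (𝓞 K)} (h3' : ((3 : ℕ) : 𝓞 K) ∈ 𝔭'.asIdeal) (hne : 𝔭' ≠ 𝔭)
    (ι' : PadicAlgCl 3 ≃+* ℂ) (hι : Summit.BirchSwinnertonDyer.BirchSwinnertonDyer.Theorems.SchneiderFree.BranchInducesPrime 3 ι' 𝔭)
    {κ₁ κ₂ : ZpExtension K 3} {γ₁ γ₂ : absoluteGaloisGroup K} (hpair : ZpExtension.IsTopGeneratorPair κ₁ κ₂ γ₁ γ₂)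
    (hur₁ : ∀ v : HeightOneSpectrum (𝓞 K), v ≠ 𝔭 → ∀ 𝔓 ∈ v.primesAbove,
      𝔓.inertia (absoluteGaloisGroup K) ≤ κ₁.kerSubgroup)
    {ΩK ΩK' : ℂ} {C X Y C' X' Y' : ℂ_[3]} {L L' : PowerSeries (UnrSeries 3)} (hΩK : ΩK ≠ 0) (hΩK' : ΩK' ≠ 0)
    (hC : C ≠ 0) (hX : X ≠ 0) (hY : Y ≠ 0) (hC' : C' ≠ 0) (hX' : X' ≠ 0) (hY' : Y' ≠ 0)
    (hL : IsToricTwoVarLFunctionUpTo₂ C X Y ι' 𝔭 𝔭' κ₁ κ₂ γ₁ γ₂ Dt.f ΩK L) (hL0 : L ≠ 0)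
    (hL' : IsToricTwoVarLFunctionUpTo₂ C' X' Y' ι' 𝔭 𝔭' κ₁ κ₂ γ₁ γ₂ Dt.f ΩK' L') (hL'0 : L' ≠ 0) :
    letI : Algebra ℤ_[3] (unrIntegers 3) := (toUnr 3).toAlgebra
    ∃ (g₀ : absoluteGaloisGroup K) (k : ℕ) (a a' : PadicComplexInt 3),
      (a : ℂ_[3]) = ((3 : ℕ) : ℂ_[3]) ^ k * C ∧ (a' : ℂ_[3]) = ((3 : ℕ) : ℂ_[3]) ^ k * C' ∧
      PowerSeries.C (PowerSeries.C a) * UnrSeries.toInt₂ L' =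
        PowerSeries.C (PowerSeries.C a') * UnrSeries.toInt₂
          ((PowerSeries.map (PowerSeries.C (R := unrIntegers 3))
              ((PowerSeries.binomialSeries ℤ_[3] (Multiplicative.toAdd (κ₁ g₀))).map (toUnr 3)) *
            PowerSeries.C ((PowerSeries.binomialSeries ℤ_[3] (Multiplicative.toAdd (κ₂ g₀))).map (toUnr 3))) * L) := by
  have hρ : ∀ {Ω : ℂ}, Ω ≠ 0 → (((ι'.symm ((Ω ^ 2)⁻¹) : PadicAlgCl 3)) : ℂ_[3]) ≠ 0 := by
    intro Ω hΩ
    rw [PadicComplex.coe_eq, map_ne_zero_iff _ (algebraMap (PadicAlgCl 3) ℂ_[3]).injective, map_ne_zero_iff _ ι'.symm.injective]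
    exact inv_ne_zero (pow_ne_zero _ hΩ)
  exact exists_groupLike_of_isToricTwoVarLFunctionUpTo₂_pair hJ hK W Dt hH h3 h3' hne ι' hι hpair hur₁
    hC (mul_ne_zero hX (hρ hΩK)) (mul_ne_zero hY (hρ hΩK)) hC' (mul_ne_zero hX' (hρ hΩK')) (mul_ne_zero hY' (hρ hΩK'))
    (FrameSizeInvariance.isToricTwoVarLFunctionUpTo₂_period_one hΩK hL) hL0
    (FrameSizeInvariance.isToricTwoVarLFunctionUpTo₂_period_one hΩK' hL') hL'0


/-- **THE ORBIT THEOREM INSIDE `R₀⟦T₁⟧⟦T₂⟧`: `s·L′ = t·[g₀]·L` with `s, t ∈ R₀ ∖ 0` and `t·C = s·C′`.** For two NON-ZERO ♯♯-frames `L`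
(constants `(C, X, Y)`) and `L′` (constants `(C′, X′, Y′)`) of one datum and period, all constants non-zero: there are `g₀ ∈ Γ_K` and NON-ZERO
`s, t ∈ R₀ = W(𝔽̄₃)` with `C (C s) · L′ = C (C t) · (1+T₁)^{κ₁ g₀}(1+T₂)^{κ₂ g₀} · L` in `R₀⟦T₁⟧⟦T₂⟧` and `t·C = s·C′` in `ℂ₃`. PROOF: compare ONE
coefficient of the `𝒪_{ℂ₃}`-identity of `…FrameOrbit.exists_groupLike_of_isToricTwoVarLFunctionUpTo₂_pair` at an index where `[g₀]·L` does not
vanish (`s` := that coefficient, `t` := the same coefficient of `L′`), then cancel `3^k·C`. CONSEQUENCE: `C′/C = t/s ∈ Frac(R₀)ˣ = 3^ℤ·R₀ˣ`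
(`R₀` is a DVR with uniformizer `3`): the constant `C` of a frame is canonical up to `Frac(W(𝔽̄₃))ˣ` — in particular `‖C′‖/‖C‖ ∈ 3^ℤ` — and
the non-zero frames form ONE orbit under `3^ℤ · R₀ˣ · Γ_K`; every ideal-theoretic statement with `3`-power slack about «all frames» (item 32493's
`∀ L₂ … ThinCombDvdRat …`) is a statement about one of them. [cite: HaoLoeffler2025, Thm. 3.5, remark (arXiv:2405.12611)]
[cite: Jacquet1972, §19 Cor. 19.15] [cite: deShalit1987, II.4.17 (54)] -/
theorem exists_unr_mul_eq_of_isToricTwoVarLFunctionUpTo₂_pair (hJ : jacquet1972_functionalEquation_rankinSelbergHecke_cone)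
    (hK : IsImaginaryQuadratic K) {N : ℕ} [NeZero N] (W : WeierstrassCurve ℚ)
    (Dt : Literature.NumberTheory.EllipticCurves.ModularForms.ModularParametrizationData W N)
    (hH : SatisfiesHeegnerHypothesis N K)
    {𝔭 : HeightOneSpectrum (𝓞 K)} (h3 : ((3 : ℕ) : 𝓞 K) ∈ 𝔭.asIdeal)
    {𝔭' : HeightOneSpectrum (𝓞 K)} (h3' : ((3 : ℕ) : 𝓞 K) ∈ 𝔭'.asIdeal) (hne : 𝔭' ≠ 𝔭)
    (ι' : PadicAlgCl 3 ≃+* ℂ) (hι : Summit.BirchSwinnertonDyer.BirchSwinnertonDyer.Theorems.SchneiderFree.BranchInducesPrime 3 ι' 𝔭)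
    {κ₁ κ₂ : ZpExtension K 3} {γ₁ γ₂ : absoluteGaloisGroup K} (hpair : ZpExtension.IsTopGeneratorPair κ₁ κ₂ γ₁ γ₂)
    (hur₁ : ∀ v : HeightOneSpectrum (𝓞 K), v ≠ 𝔭 → ∀ 𝔓 ∈ v.primesAbove,
      𝔓.inertia (absoluteGaloisGroup K) ≤ κ₁.kerSubgroup)
    {ΩK : ℂ} {C X Y C' X' Y' : ℂ_[3]} {L L' : PowerSeries (UnrSeries 3)}
    (hC : C ≠ 0) (hX : X ≠ 0) (hY : Y ≠ 0) (hC' : C' ≠ 0) (hX' : X' ≠ 0) (hY' : Y' ≠ 0)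
    (hL : IsToricTwoVarLFunctionUpTo₂ C X Y ι' 𝔭 𝔭' κ₁ κ₂ γ₁ γ₂ Dt.f ΩK L) (hL0 : L ≠ 0)
    (hL' : IsToricTwoVarLFunctionUpTo₂ C' X' Y' ι' 𝔭 𝔭' κ₁ κ₂ γ₁ γ₂ Dt.f ΩK L') (hL'0 : L' ≠ 0) :
    letI : Algebra ℤ_[3] (unrIntegers 3) := (toUnr 3).toAlgebra
    ∃ (g₀ : absoluteGaloisGroup K) (s t : unrIntegers 3), s ≠ 0 ∧ t ≠ 0 ∧ (t : ℂ_[3]) * C = (s : ℂ_[3]) * C' ∧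
      PowerSeries.C (PowerSeries.C s) * L' =
        PowerSeries.C (PowerSeries.C t) *
          ((PowerSeries.map (PowerSeries.C (R := unrIntegers 3))
              ((PowerSeries.binomialSeries ℤ_[3] (Multiplicative.toAdd (κ₁ g₀))).map (toUnr 3)) *
            PowerSeries.C ((PowerSeries.binomialSeries ℤ_[3] (Multiplicative.toAdd (κ₂ g₀))).map (toUnr 3))) * L) := by
  letI : Algebra ℤ_[3] (unrIntegers 3) := (toUnr 3).toAlgebra
  obtain ⟨g₀, k, a, a', ha, ha', hid⟩ := exists_groupLike_of_isToricTwoVarLFunctionUpTo₂_pair hJ hK W Dt hH h3 h3' hne ι' hι hpair hur₁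
    hC hX hY hC' hX' hY' hL hL0 hL' hL'0
  set B : PowerSeries (UnrSeries 3) := PowerSeries.map (PowerSeries.C (R := unrIntegers 3))
      ((PowerSeries.binomialSeries ℤ_[3] (Multiplicative.toAdd (κ₁ g₀))).map (toUnr 3)) *
    PowerSeries.C ((PowerSeries.binomialSeries ℤ_[3] (Multiplicative.toAdd (κ₂ g₀))).map (toUnr 3)) with hB
  have hBL0 : B * L ≠ 0 := fun h0 ↦ hL0 (((FrameUniqueness.isUnit_groupLike (p := 3) _ _).mul_right_eq_zero).mp h0)
  -- an index where `[g₀]·L` does not vanish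
  obtain ⟨p, hp⟩ : ∃ p, PowerSeries.coeff p (B * L) ≠ 0 := by
    by_contra hall
    push Not at hall
    exact hBL0 (PowerSeries.ext fun n ↦ by rw [hall n, map_zero])
  obtain ⟨q, hq⟩ : ∃ q, PowerSeries.coeff q (PowerSeries.coeff p (B * L)) ≠ 0 := by
    by_contra hall
    push Not at hall
    exact hp (PowerSeries.ext fun n ↦ by rw [hall n, map_zero])
  -- the coefficientwise identity `a · L′_{p′q′} = a′ · ([g₀]L)_{p′q′}` in `ℂ₃`
  have hcoef : ∀ p' q' : ℕ, (a : ℂ_[3]) * ((PowerSeries.coeff q' (PowerSeries.coeff p' L') : unrIntegers 3) : ℂ_[3]) =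
      (a' : ℂ_[3]) * ((PowerSeries.coeff q' (PowerSeries.coeff p' (B * L)) : unrIntegers 3) : ℂ_[3]) := by
    intro p' q'
    have h := congrArg (fun F ↦ ((PowerSeries.coeff q' (PowerSeries.coeff p' F) : PadicComplexInt 3) : ℂ_[3])) hid
    simp only [PowerSeries.coeff_C_mul] at h
    push_cast at h
    rwa [UnrSeries.coe_coeff_coeff_toInt₂, UnrSeries.coe_coeff_coeff_toInt₂] at h
  set s : unrIntegers 3 := PowerSeries.coeff q (PowerSeries.coeff p (B * L)) with hs
  set t : unrIntegers 3 := PowerSeries.coeff q (PowerSeries.coeff p L') with ht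
  have h30 : ((3 : ℕ) : ℂ_[3]) ≠ 0 := by exact_mod_cast (show (3 : ℕ) ≠ 0 by norm_num)
  have h3k : ((3 : ℕ) : ℂ_[3]) ^ k ≠ 0 := pow_ne_zero _ h30
  have hs0' : (s : ℂ_[3]) ≠ 0 := fun h ↦ hq (Subtype.ext h)
  -- `t·C = s·C′` (the `(p, q)` instance, `3^k` cancelled)
  have htC : (t : ℂ_[3]) * C = (s : ℂ_[3]) * C' := by
    have h := hcoef p q
    rw [ha, ha'] at h
    -- h : 3^k * C * t = 3^k * C' * s
    have h' : ((3 : ℕ) : ℂ_[3]) ^ k * ((t : ℂ_[3]) * C) = ((3 : ℕ) : ℂ_[3]) ^ k * ((s : ℂ_[3]) * C') := by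
      calc ((3 : ℕ) : ℂ_[3]) ^ k * ((t : ℂ_[3]) * C) = ((3 : ℕ) : ℂ_[3]) ^ k * C * (t : ℂ_[3]) := by ring
        _ = ((3 : ℕ) : ℂ_[3]) ^ k * C' * (s : ℂ_[3]) := h
        _ = ((3 : ℕ) : ℂ_[3]) ^ k * ((s : ℂ_[3]) * C') := by ring
    exact mul_left_cancel₀ h3k h'
  have ht0 : t ≠ 0 := by
    intro h0
    have : (s : ℂ_[3]) * C' = 0 := by rw [← htC, h0]; simp
    rcases mul_eq_zero.mp this with h1 | h1
    · exact hs0' h1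
    · exact hC' h1
  refine ⟨g₀, s, t, fun h ↦ hq h, ht0, htC, ?_⟩
  -- the identity in `R₀⟦T₁⟧⟦T₂⟧`, coefficient by coefficient
  ext p' q' : 2
  rw [PowerSeries.coeff_C_mul, PowerSeries.coeff_C_mul, PowerSeries.coeff_C_mul, PowerSeries.coeff_C_mul]
  apply Subtype.ext
  push_cast
  have h := hcoef p' q'
  rw [ha, ha'] at h
  -- h : 3^k * C * L′_{p′q′} = 3^k * C′ * (BL)_{p′q′}; multiply by `s` and use `s·C′ = t·C`
  have h2 : ((3 : ℕ) : ℂ_[3]) ^ k * C * ((s : ℂ_[3]) * ((PowerSeries.coeff q' (PowerSeries.coeff p' L') : unrIntegers 3) : ℂ_[3])) =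
      ((3 : ℕ) : ℂ_[3]) ^ k * C * ((t : ℂ_[3]) * ((PowerSeries.coeff q' (PowerSeries.coeff p' (B * L)) : unrIntegers 3) : ℂ_[3])) := by
    calc ((3 : ℕ) : ℂ_[3]) ^ k * C * ((s : ℂ_[3]) * ((PowerSeries.coeff q' (PowerSeries.coeff p' L') : unrIntegers 3) : ℂ_[3]))
        = (s : ℂ_[3]) * (((3 : ℕ) : ℂ_[3]) ^ k * C * ((PowerSeries.coeff q' (PowerSeries.coeff p' L') : unrIntegers 3) : ℂ_[3])) := by ring
      _ = (s : ℂ_[3]) * (((3 : ℕ) : ℂ_[3]) ^ k * C' * ((PowerSeries.coeff q' (PowerSeries.coeff p' (B * L)) : unrIntegers 3) : ℂ_[3])) := by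
          rw [h]
      _ = ((3 : ℕ) : ℂ_[3]) ^ k * ((s : ℂ_[3]) * C') * ((PowerSeries.coeff q' (PowerSeries.coeff p' (B * L)) : unrIntegers 3) : ℂ_[3]) := by
          ring
      _ = ((3 : ℕ) : ℂ_[3]) ^ k * ((t : ℂ_[3]) * C) * ((PowerSeries.coeff q' (PowerSeries.coeff p' (B * L)) : unrIntegers 3) : ℂ_[3]) := by
          rw [htC]
      _ = ((3 : ℕ) : ℂ_[3]) ^ k * C * ((t : ℂ_[3]) * ((PowerSeries.coeff q' (PowerSeries.coeff p' (B * L)) : unrIntegers 3) : ℂ_[3])) := by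
          ring
  exact mul_left_cancel₀ (mul_ne_zero h3k hC) h2

/-! ### Rational thin-comb divisibility is constant on the orbit (item 32493's `∀ L₂` is decided by one non-zero frame)

#### Slack-tolerant comb divisibility under unit-times-`p`-power rescaling (any `𝒪`, `p`) -/

section Algebra

variable {𝒪 : Type*} [CommRing 𝒪] (p : ℕ)

/-- `ThinCombDvdRat G F → ThinCombDvdRat G (B·F)` for any `B` (the ideals `(G, E_m)` absorb `B`; same levels, same slack).
[cite: Washington1997, §7.1] -/
theorem ThinCombDvdRat.mul_left {G F : PowerSeries (PowerSeries 𝒪)} (B : PowerSeries (PowerSeries 𝒪))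
    (h : ThinCombDvdRat 𝒪 p G F) : ThinCombDvdRat 𝒪 p G (B * F) := by
  intro n
  obtain ⟨m, hnm, t, hmem⟩ := h n
  refine ⟨m, hnm, t, ?_⟩
  have e : const 𝒪 ((p : 𝒪) ^ t) * (B * F) = B * (const 𝒪 ((p : 𝒪) ^ t) * F) := by ring
  rw [e]
  exact Ideal.mul_mem_left _ B hmem

/-- **Transfer along `const s · F′ = const t · F` with `s = u·p^b`, `u` a unit**: `ThinCombDvdRat G F → ThinCombDvdRat G F′` (slack `t_m + b`:
`p^{t_m+b}·F′ = u⁻¹·t·(p^{t_m}·F)`). [cite: Washington1997, §7.1] -/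
theorem ThinCombDvdRat.of_const_mul_eq {G F F' : PowerSeries (PowerSeries 𝒪)} {s t : 𝒪} (u : 𝒪ˣ) (b : ℕ)
    (hs : s = (u : 𝒪) * (p : 𝒪) ^ b)
    (heq : PowerSeries.C (PowerSeries.C s) * F' = PowerSeries.C (PowerSeries.C t) * F)
    (h : ThinCombDvdRat 𝒪 p G F) : ThinCombDvdRat 𝒪 p G F' := by
  have heq' : const 𝒪 s * F' = const 𝒪 t * F := heq
  have hcu : const 𝒪 ((u⁻¹ : 𝒪ˣ) : 𝒪) * const 𝒪 (u : 𝒪) = 1 := by rw [← map_mul, Units.inv_mul, map_one]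
  intro n
  obtain ⟨m, hnm, t₀, hmem⟩ := h n
  refine ⟨m, hnm, t₀ + b, ?_⟩
  have e : const 𝒪 ((p : 𝒪) ^ (t₀ + b)) * F' =
      (const 𝒪 ((u⁻¹ : 𝒪ˣ) : 𝒪) * const 𝒪 t) * (const 𝒪 ((p : 𝒪) ^ t₀) * F) := by
    calc const 𝒪 ((p : 𝒪) ^ (t₀ + b)) * F'
        = const 𝒪 ((p : 𝒪) ^ t₀) * (const 𝒪 ((u⁻¹ : 𝒪ˣ) : 𝒪) * const 𝒪 (u : 𝒪)) * const 𝒪 ((p : 𝒪) ^ b) * F' := by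
          rw [hcu, mul_one, pow_add, map_mul]
      _ = const 𝒪 ((u⁻¹ : 𝒪ˣ) : 𝒪) * const 𝒪 ((p : 𝒪) ^ t₀) * (const 𝒪 s * F') := by rw [hs, map_mul]; ring
      _ = const 𝒪 ((u⁻¹ : 𝒪ˣ) : 𝒪) * const 𝒪 ((p : 𝒪) ^ t₀) * (const 𝒪 t * F) := by rw [heq']
      _ = (const 𝒪 ((u⁻¹ : 𝒪ˣ) : 𝒪) * const 𝒪 t) * (const 𝒪 ((p : 𝒪) ^ t₀) * F) := by ring
  rw [e]
  exact Ideal.mul_mem_left _ _ hmem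

/-- The zero series satisfies `ThinCombDvdRat G 0` on every level with slack `0`. [cite: Washington1997, §7.1] -/
theorem thinCombDvdRat_zero (G : PowerSeries (PowerSeries 𝒪)) : ThinCombDvdRat 𝒪 p G 0 := fun n ↦
  ⟨n, le_rfl, 0, by rw [mul_zero]; exact Ideal.zero_mem _⟩

end Algebra

/-! #### Item 32493's divisibility is constant on the orbit of ♯♯-frames (`p = 3`) -/

/-- **RATIONAL THIN-COMB DIVISIBILITY PASSES BETWEEN NON-ZERO ♯♯-FRAMES.** `K` imaginary quadratic Heegner for `N`, `3 = 𝔭𝔭′` with `𝔭` of degree one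
induced by `ι′`, `(κ₁, κ₂; γ₁, γ₂)` a generator pair with `κ₁` unramified outside `𝔭`, `f = Dt.f`; Jacquet's cone fact BY NAME. For two NON-ZERO
♯♯-frames `L` (constants `(C, X, Y)`) and `L′` (constants `(C′, X′, Y′)`) of the datum, same period, all constants non-zero, and ANY `G ∈ R₀⟦T₁⟧⟦T₂⟧`:
`ThinCombDvdRat R₀ 3 G L → ThinCombDvdRat R₀ 3 G L′` (orbit theorem `s·L′ = t·[g₀]·L` in `R₀⟦T₁⟧⟦T₂⟧`, `s = u·3^b` in the DVR `R₀`).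
[cite: Washington1997, §7.1, Prop. 7.2] [cite: HaoLoeffler2025, Thm. 3.5, remark (arXiv:2405.12611)] [cite: Jacquet1972, §19 Cor. 19.15] -/
theorem thinCombDvdRat_of_isToricTwoVarLFunctionUpTo₂_pair (hJ : jacquet1972_functionalEquation_rankinSelbergHecke_cone)
    (hK : IsImaginaryQuadratic K) {N : ℕ} [NeZero N] (W : WeierstrassCurve ℚ)
    (Dt : Literature.NumberTheory.EllipticCurves.ModularForms.ModularParametrizationData W N)
    (hH : SatisfiesHeegnerHypothesis N K)
    {𝔭 : HeightOneSpectrum (𝓞 K)} (h3 : ((3 : ℕ) : 𝓞 K) ∈ 𝔭.asIdeal)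
    {𝔭' : HeightOneSpectrum (𝓞 K)} (h3' : ((3 : ℕ) : 𝓞 K) ∈ 𝔭'.asIdeal) (hne : 𝔭' ≠ 𝔭)
    (ι' : PadicAlgCl 3 ≃+* ℂ) (hι : Summit.BirchSwinnertonDyer.BirchSwinnertonDyer.Theorems.SchneiderFree.BranchInducesPrime 3 ι' 𝔭)
    {κ₁ κ₂ : ZpExtension K 3} {γ₁ γ₂ : absoluteGaloisGroup K} (hpair : ZpExtension.IsTopGeneratorPair κ₁ κ₂ γ₁ γ₂)
    (hur₁ : ∀ v : HeightOneSpectrum (𝓞 K), v ≠ 𝔭 → ∀ 𝔓 ∈ v.primesAbove,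
      𝔓.inertia (absoluteGaloisGroup K) ≤ κ₁.kerSubgroup)
    {ΩK : ℂ} {C X Y C' X' Y' : ℂ_[3]} {L L' : PowerSeries (UnrSeries 3)}
    (hC : C ≠ 0) (hX : X ≠ 0) (hY : Y ≠ 0) (hC' : C' ≠ 0) (hX' : X' ≠ 0) (hY' : Y' ≠ 0)
    (hL : IsToricTwoVarLFunctionUpTo₂ C X Y ι' 𝔭 𝔭' κ₁ κ₂ γ₁ γ₂ Dt.f ΩK L) (hL0 : L ≠ 0)
    (hL' : IsToricTwoVarLFunctionUpTo₂ C' X' Y' ι' 𝔭 𝔭' κ₁ κ₂ γ₁ γ₂ Dt.f ΩK L') (hL'0 : L' ≠ 0)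
    (G : PowerSeries (UnrSeries 3)) (h : ThinCombDvdRat (unrIntegers 3) 3 G L) :
    ThinCombDvdRat (unrIntegers 3) 3 G L' := by
  letI : Algebra ℤ_[3] (unrIntegers 3) := (toUnr 3).toAlgebra
  obtain ⟨g₀, s, t, hs0, -, -, hid⟩ :=
    exists_unr_mul_eq_of_isToricTwoVarLFunctionUpTo₂_pair hJ hK W Dt hH h3 h3' hne ι' hι hpair hur₁
      hC hX hY hC' hX' hY' hL hL0 hL' hL'0
  haveI := Summit.BirchSwinnertonDyer.Rank1Residual.X2.HidaLimitAlgebra.isDiscreteValuationRing_unrIntegers (p := 3)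
  obtain ⟨b, u, hsu⟩ := IsDiscreteValuationRing.eq_unit_mul_pow_irreducible hs0
    (Summit.BirchSwinnertonDyer.Rank1Residual.X2.HidaLimitAlgebra.irreducible_natCast_p (p := 3))
  exact ThinCombDvdRat.of_const_mul_eq 3 u b hsu hid (ThinCombDvdRat.mul_left 3 _ h)

/-- **ITEM 32493's `∀ L₂` IS DECIDED BY ONE NON-ZERO FRAME.** Same datum; if SOME non-zero ♯♯-frame `L` (constants `C, X, Y ≠ 0`, period `Ω_K`) has
`ThinCombDvdRat R₀ 3 G L`, then EVERY ♯♯-frame `L′` of the datum (constants `C′, X′, Y′ ≠ 0`, period `Ω_K`) has `ThinCombDvdRat R₀ 3 G L′`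
(the zero frame trivially). [cite: Washington1997, §7.1, Prop. 7.2] [cite: Gu2025FiniteSlopeUniversalRS, Conj. 2.15 (arXiv:2512.01184)]
[cite: Jacquet1972, §19 Cor. 19.15] -/
theorem thinCombDvdRat_of_exists_frame (hJ : jacquet1972_functionalEquation_rankinSelbergHecke_cone)
    (hK : IsImaginaryQuadratic K) {N : ℕ} [NeZero N] (W : WeierstrassCurve ℚ)
    (Dt : Literature.NumberTheory.EllipticCurves.ModularForms.ModularParametrizationData W N)
    (hH : SatisfiesHeegnerHypothesis N K)
    {𝔭 : HeightOneSpectrum (𝓞 K)} (h3 : ((3 : ℕ) : 𝓞 K) ∈ 𝔭.asIdeal)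
    {𝔭' : HeightOneSpectrum (𝓞 K)} (h3' : ((3 : ℕ) : 𝓞 K) ∈ 𝔭'.asIdeal) (hne : 𝔭' ≠ 𝔭)
    (ι' : PadicAlgCl 3 ≃+* ℂ) (hι : Summit.BirchSwinnertonDyer.BirchSwinnertonDyer.Theorems.SchneiderFree.BranchInducesPrime 3 ι' 𝔭)
    {κ₁ κ₂ : ZpExtension K 3} {γ₁ γ₂ : absoluteGaloisGroup K} (hpair : ZpExtension.IsTopGeneratorPair κ₁ κ₂ γ₁ γ₂)
    (hur₁ : ∀ v : HeightOneSpectrum (𝓞 K), v ≠ 𝔭 → ∀ 𝔓 ∈ v.primesAbove,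
      𝔓.inertia (absoluteGaloisGroup K) ≤ κ₁.kerSubgroup)
    {ΩK : ℂ} (G : PowerSeries (UnrSeries 3))
    (hex : ∃ (C X Y : ℂ_[3]) (L : PowerSeries (UnrSeries 3)), C ≠ 0 ∧ X ≠ 0 ∧ Y ≠ 0 ∧ L ≠ 0 ∧
      IsToricTwoVarLFunctionUpTo₂ C X Y ι' 𝔭 𝔭' κ₁ κ₂ γ₁ γ₂ Dt.f ΩK L ∧ ThinCombDvdRat (unrIntegers 3) 3 G L)
    {C' X' Y' : ℂ_[3]} {L' : PowerSeries (UnrSeries 3)} (hC' : C' ≠ 0) (hX' : X' ≠ 0) (hY' : Y' ≠ 0)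
    (hL' : IsToricTwoVarLFunctionUpTo₂ C' X' Y' ι' 𝔭 𝔭' κ₁ κ₂ γ₁ γ₂ Dt.f ΩK L') :
    ThinCombDvdRat (unrIntegers 3) 3 G L' := by
  by_cases hL'0 : L' = 0
  · rw [hL'0]; exact thinCombDvdRat_zero 3 G
  obtain ⟨C, X, Y, L, hC, hX, hY, hL0, hL, h⟩ := hex
  exact thinCombDvdRat_of_isToricTwoVarLFunctionUpTo₂_pair hJ hK W Dt hH h3 h3' hne ι' hι hpair hur₁ hC hX hY hC' hX' hY' hL hL0 hL' hL'0 G h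

end Summit.BirchSwinnertonDyer.BirchSwinnertonDyer.Theorems.UniversalToricDescentThinComb.FrameOrbitCorollaries

end
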